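import Summits.QuantumAdvantage.AdviceFreeQNC0.BondTwist
import Summits.QuantumAdvantage.AdviceFreeQNC0.TwistedTransfer
import Summits.QuantumAdvantage.AdviceFreeQNC0.FixedBellsDense
import Summits.QuantumAdvantage.AdviceFreeQNC0.DWalkOneBell
import HarnessLib

/-!
# Cell qa-qnc0, `p = 3` — the BOND-TWISTED 6-state path sum (planner qa-qnc0-p1 g20, ask P-20a(1); ROUND-19 §2;
`exp20/Sketch20x.lean` §1)

The x-LINEAR phase `e₃(Σ_{i : x_i} γ_i)` in walk coordinates `u` (`x_j = ¬(u_j ⊕ u_{j-1})`, `u_{-1} = 0`, `u_n = 1`) is a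
BOND statistic of the step sequence, so the correlation sums of a constant-bell strategy with it are path sums of a
6-state chain (walk position mod 3, previous step):

* `BTV Φ f k a E c` — the bond-twisted backward vectors; **`bond_pathSum_eq`** — the path-sum identity
  `Σ_{u ∈ {0,1}^k} (Π_g f_{a+g}(E + pos_g u))·(Π_g bond phases) = BTV Φ f k a E c`;
* **`cnsq6_BTV_succ_le_four` / `cnsq6_BTV_succ_le_three`** — one step costs a factor `4` in squared `ℓ²` norm, and only
  `3` at a site whose phase is a primitive cube root (the pair inequality `twAvgX_core`, valid because the bell sign depends
  on the walk POSITION only);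
* `sum_odd_eq_sum_u` — sums over the odd class transported through the chart `uVec` (a bijection onto `{0,1}^n`).

Consumer: `twistBoundX3 : TwistBoundX3` (`TwistBoundX3Proof.lean`).

WHAT THIS IS NOT: no strategy bound by itself; crux 22907 untouched; separation NOT moved.
-/

noncomputable section

namespace Summit.QuantumAdvantage.AdviceFreeQNC0

open Finset Literature.Computability.MetaComplexity

namespace BondTwist3

open TransferWalk ConstBells TwistedTransfer

variable {n : ℕ}

/-! ## Sums over the odd class through the chart -/

/-- **Transport of sums**: `Σ_{x odd} F(uVec x) = Σ_u F u` (`uVec` is a bijection from the odd class onto `{0,1}^n`). -/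
theorem sum_odd_eq_sum_u (hn : 2 ≤ n) (F : (Fin n → Bool) → ℂ) :
    ∑ x ∈ (univ.filter fun x : Fin (n + 1) → Bool =>
        (univ.filter fun j : Fin (n + 1) => x j = false).card % 2 = 1), F (uVec x) =
      ∑ u : Fin n → Bool, F u := by
  refine Finset.sum_bij (fun x _ => uVec x) (fun _ _ => mem_univ _) ?_ ?_ (fun _ _ => rfl)
  · intro x₁ hx₁ x₂ hx₂ h
    rw [mem_filter] at hx₁ hx₂
    rw [← xOfU_uVec hn x₁ hx₁.2, ← xOfU_uVec hn x₂ hx₂.2, h]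
  · intro u _
    have hsurj := Finset.surj_on_of_inj_on_of_card_le (s := univ.filter fun x : Fin (n + 1) → Bool =>
        (univ.filter fun j : Fin (n + 1) => x j = false).card % 2 = 1) (t := (univ : Finset (Fin n → Bool)))
      (fun x _ => uVec x) (fun _ _ => mem_univ _)
      (fun x₁ x₂ hx₁ hx₂ h => by
        rw [mem_filter] at hx₁ hx₂
        rw [← xOfU_uVec hn x₁ hx₁.2, ← xOfU_uVec hn x₂ hx₂.2, h])
      (by rw [card_univ, Fintype.card_fun, Fintype.card_bool, Fintype.card_fin]; exact two_pow_le_card_odd_class)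
    obtain ⟨x, hx, hxu⟩ := hsurj u (mem_univ _)
    exact ⟨x, hx, hxu.symm⟩

/-! ## The bond-twisted backward vectors -/

/-- The walk step of a bit: `+1` for `0`, `+2` for `1`. -/
def stepZ (b : Bool) : ZMod 3 := if b then 2 else 1

/-- The bond phase at site `j`: the x-bit there is `[current step = previous step]`, phase `Φ j` if it is `1`. -/
def bondPh (Φ : ℕ → ℂ) (j : ℕ) (c b : Bool) : ℂ := if b = c then Φ j else 1

/-- The step sequence extended by the previous step `c` in front and the terminal step `1` behind. -/
def ext {k : ℕ} (c : Bool) (u : Fin k → Bool) : ℕ → Bool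
  | 0 => c
  | g + 1 => if h : g < k then u ⟨g, h⟩ else true

/-- **Bond-twisted backward vectors**: `BTV Φ f k a E c` = the bond-twisted path sum over `k` steps starting at cut `a` in
walk state `E` with previous step `c`, the terminal step being `1`. -/
def BTV (Φ : ℕ → ℂ) (f : ℕ → ZMod 3 → ℝ) : ℕ → ℕ → ZMod 3 → Bool → ℂ
  | 0, a, E, c => (f a E : ℂ) * bondPh Φ a c true
  | k + 1, a, E, c => (f a E : ℂ) * ∑ b : Bool, bondPh Φ a c b * BTV Φ f k (a + 1) (E + stepZ b) b

/-- `ext c u 0 = c`. -/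
theorem ext_zero {k : ℕ} (c : Bool) (u : Fin k → Bool) : ext c u 0 = c := rfl

/-- Peeling the first step: `ext c (b :: u) (g+1) = ext b u g`. -/
theorem ext_cons_succ {k : ℕ} (c b : Bool) (u : Fin k → Bool) (g : ℕ) :
    ext c (Fin.cons b u : Fin (k + 1) → Bool) (g + 1) = ext b u g := by
  cases g with
  | zero => simp [ext]
  | succ g =>
    simp only [ext]
    by_cases h : g < k
    · rw [dif_pos (by omega), dif_pos h]
      exact Fin.cons_succ (α := fun _ : Fin (k + 1) => Bool) b u ⟨g, h⟩
    · rw [dif_neg (by omega), dif_neg h]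

/-- No steps: `ext c u 1 = true`. -/
theorem ext_one_of_zero (c : Bool) (u : Fin 0 → Bool) : ext c u 1 = true := by
  simp [ext]

/-- The bond-twisted summand of the path sum. -/
def bondSummand (Φ : ℕ → ℂ) (f : ℕ → ZMod 3 → ℝ) (k a : ℕ) (E : ZMod 3) (c : Bool) (u : Fin k → Bool) : ℂ :=
  (∏ g ∈ range (k + 1), (f (a + g) (E + posZ u g) : ℂ)) *
    ∏ g ∈ range (k + 1), bondPh Φ (a + g) (ext c u g) (ext c u (g + 1))

/-- Peeling the first step off the summand. -/
theorem bondSummand_cons (Φ : ℕ → ℂ) (f : ℕ → ZMod 3 → ℝ) (k a : ℕ) (E : ZMod 3) (c b : Bool) (u : Fin k → Bool) :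
    bondSummand Φ f (k + 1) a E c (Fin.cons b u : Fin (k + 1) → Bool) =
      (f a E : ℂ) * bondPh Φ a c b * bondSummand Φ f k (a + 1) (E + stepZ b) b u := by
  unfold bondSummand
  rw [Finset.prod_range_succ' (fun g => (f (a + g) (E + posZ (Fin.cons b u : Fin (k + 1) → Bool) g) : ℂ)),
    Finset.prod_range_succ' (fun g => bondPh Φ (a + g) (ext c (Fin.cons b u : Fin (k + 1) → Bool) g)
      (ext c (Fin.cons b u : Fin (k + 1) → Bool) (g + 1)))]
  have hg : ∀ g : ℕ, E + posZ (Fin.cons b u : Fin (k + 1) → Bool) (g + 1) = E + stepZ b + posZ u g := by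
    intro g; rw [posZ_cons_succ, add_assoc]; rfl
  have h1 : (∏ g ∈ range (k + 1), (f (a + (g + 1)) (E + posZ (Fin.cons b u : Fin (k + 1) → Bool) (g + 1)) : ℂ)) =
      ∏ g ∈ range (k + 1), (f (a + 1 + g) (E + stepZ b + posZ u g) : ℂ) :=
    Finset.prod_congr rfl fun g _ => by rw [hg g, show a + (g + 1) = a + 1 + g by omega]
  have h2 : (∏ g ∈ range (k + 1), bondPh Φ (a + (g + 1)) (ext c (Fin.cons b u : Fin (k + 1) → Bool) (g + 1))
      (ext c (Fin.cons b u : Fin (k + 1) → Bool) (g + 1 + 1))) =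
      ∏ g ∈ range (k + 1), bondPh Φ (a + 1 + g) (ext b u g) (ext b u (g + 1)) :=
    Finset.prod_congr rfl fun g _ => by rw [ext_cons_succ, ext_cons_succ, show a + (g + 1) = a + 1 + g by omega]
  have h3 : (f (a + 0) (E + posZ (Fin.cons b u : Fin (k + 1) → Bool) 0) : ℂ) = f a E := by
    rw [posZ_zero, add_zero, add_zero]
  have h4 : bondPh Φ (a + 0) (ext c (Fin.cons b u : Fin (k + 1) → Bool) 0)
      (ext c (Fin.cons b u : Fin (k + 1) → Bool) (0 + 1)) = bondPh Φ a c b := by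
    rw [add_zero, zero_add, ext_zero, ext_cons_succ, ext_zero]
  rw [h1, h2, h3, h4]
  ring

/-- **The bond-twisted path-sum identity.** -/
theorem bond_pathSum_eq (Φ : ℕ → ℂ) (f : ℕ → ZMod 3 → ℝ) : ∀ (k a : ℕ) (E : ZMod 3) (c : Bool),
    ∑ u : Fin k → Bool, bondSummand Φ f k a E c u = BTV Φ f k a E c
  | 0, a, E, c => by
    rw [Fintype.sum_subsingleton _ (fun i => Fin.elim0 i)]
    unfold bondSummand
    simp [posZ_zero, BTV, ext_zero, ext_one_of_zero]
  | k + 1, a, E, c => by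
    have hsplit : ∑ u : Fin (k + 1) → Bool, bondSummand Φ f (k + 1) a E c u =
        ∑ b : Bool, ∑ u : Fin k → Bool, bondSummand Φ f (k + 1) a E c (Fin.cons b u : Fin (k + 1) → Bool) := by
      rw [← Fintype.sum_prod_type']
      exact (Fintype.sum_equiv (Fin.consEquiv fun _ => Bool) _ _ fun p => rfl).symm
    rw [hsplit]
    simp only [bondSummand_cons, ← Finset.mul_sum]
    simp only [bond_pathSum_eq Φ f k, BTV, Finset.mul_sum]
    refine Finset.sum_congr rfl fun b _ => ?_
    ring

/-! ## Norm recursion -/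

/-- The squared `ℓ²` norm of the `k`-step vector at cut `a`. -/
def btvNorm (Φ : ℕ → ℂ) (f : ℕ → ZMod 3 → ℝ) (k a : ℕ) : ℝ := cnsq6 fun E c => BTV Φ f k a E c

/-- Re-indexing `E ↦ E + d` on `ZMod 3`. -/
theorem sum_shift (d : ZMod 3) (G : ZMod 3 → ℝ) : ∑ E : ZMod 3, G (E + d) = ∑ E : ZMod 3, G E :=
  Fintype.sum_equiv (Equiv.addRight d) _ _ fun _ => rfl

/-- One step of the recursion, written out. -/
theorem BTV_succ (Φ : ℕ → ℂ) (f : ℕ → ZMod 3 → ℝ) (k a : ℕ) (E : ZMod 3) (c : Bool) :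
    BTV Φ f (k + 1) a E c = (f a E : ℂ) * (bondPh Φ a c false * BTV Φ f k (a + 1) (E + 1) false +
      bondPh Φ a c true * BTV Φ f k (a + 1) (E + 2) true) := by
  rw [BTV, Fintype.sum_bool, add_comm]
  simp [stepZ]

/-- **Generic step**: with `|f| ≤ 1` and `‖Φ a‖ ≤ 1`, one step costs at most a factor `4` in squared norm. -/
theorem btvNorm_succ_le_four (Φ : ℕ → ℂ) (f : ℕ → ZMod 3 → ℝ) (hf : ∀ j s, f j s ^ 2 ≤ 1) (k a : ℕ)
    (hΦ : ‖Φ a‖ ≤ 1) : btvNorm Φ f (k + 1) a ≤ 4 * btvNorm Φ f k (a + 1) := by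
  unfold btvNorm cnsq6
  have hph : ∀ c b : Bool, ‖bondPh Φ a c b‖ ≤ 1 := by
    intro c b; unfold bondPh; split_ifs
    · exact hΦ
    · simp
  have hfa : ∀ E : ZMod 3, ‖(f a E : ℂ)‖ ≤ 1 := by
    intro E
    rw [Complex.norm_real, Real.norm_eq_abs]
    have := hf a E
    nlinarith [abs_nonneg (f a E), sq_abs (f a E)]
  have hpt : ∀ (E : ZMod 3) (c : Bool), ‖BTV Φ f (k + 1) a E c‖ ^ 2 ≤
      2 * (‖BTV Φ f k (a + 1) (E + 1) false‖ ^ 2 + ‖BTV Φ f k (a + 1) (E + 2) true‖ ^ 2) := by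
    intro E c
    rw [BTV_succ]
    set P := BTV Φ f k (a + 1) (E + 1) false
    set Q := BTV Φ f k (a + 1) (E + 2) true
    have h1 : ‖(f a E : ℂ) * (bondPh Φ a c false * P + bondPh Φ a c true * Q)‖ ≤ ‖P‖ + ‖Q‖ := by
      rw [norm_mul]
      refine (mul_le_of_le_one_left (norm_nonneg _) (hfa E)).trans ?_
      refine (norm_add_le _ _).trans (add_le_add ?_ ?_)
      · rw [norm_mul]; exact mul_le_of_le_one_left (norm_nonneg _) (hph c false)
      · rw [norm_mul]; exact mul_le_of_le_one_left (norm_nonneg _) (hph c true)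
    have h0 : 0 ≤ ‖(f a E : ℂ) * (bondPh Φ a c false * P + bondPh Φ a c true * Q)‖ := norm_nonneg _
    nlinarith [sq_nonneg (‖P‖ - ‖Q‖), norm_nonneg P, norm_nonneg Q]
  calc ∑ E : ZMod 3, (‖BTV Φ f (k + 1) a E true‖ ^ 2 + ‖BTV Φ f (k + 1) a E false‖ ^ 2)
      ≤ ∑ E : ZMod 3, 4 * (‖BTV Φ f k (a + 1) (E + 1) false‖ ^ 2 + ‖BTV Φ f k (a + 1) (E + 2) true‖ ^ 2) :=
        sum_le_sum fun E _ => by have := hpt E true; have := hpt E false; linarith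
    _ = 4 * ((∑ E : ZMod 3, ‖BTV Φ f k (a + 1) (E + 1) false‖ ^ 2) +
          ∑ E : ZMod 3, ‖BTV Φ f k (a + 1) (E + 2) true‖ ^ 2) := by rw [← sum_add_distrib, mul_sum]
    _ = 4 * ∑ E : ZMod 3, (‖BTV Φ f k (a + 1) E true‖ ^ 2 + ‖BTV Φ f k (a + 1) E false‖ ^ 2) := by
        rw [sum_shift 1 (fun E => ‖BTV Φ f k (a + 1) E false‖ ^ 2),
          sum_shift 2 (fun E => ‖BTV Φ f k (a + 1) E true‖ ^ 2), sum_add_distrib, add_comm]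

/-- **Twisted step**: at a site whose phase is a primitive cube root, one step costs only a factor `3` — the pair
inequality `twAvgX_core`, applicable because the sign `f a E` is common to the two outputs `(E, 0)`, `(E, 1)`. -/
theorem btvNorm_succ_le_three (Φ : ℕ → ℂ) (f : ℕ → ZMod 3 → ℝ) (hf : ∀ j s, f j s ^ 2 ≤ 1) (k a : ℕ)
    (hΦ3 : Φ a ^ 3 = 1) (hΦ1 : Φ a ≠ 1) : btvNorm Φ f (k + 1) a ≤ 3 * btvNorm Φ f k (a + 1) := by
  unfold btvNorm cnsq6
  have hfa : ∀ E : ZMod 3, ‖(f a E : ℂ)‖ ^ 2 ≤ 1 := by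
    intro E
    rw [Complex.norm_real, Real.norm_eq_abs, sq_abs]
    exact hf a E
  have hpt : ∀ E : ZMod 3, ‖BTV Φ f (k + 1) a E true‖ ^ 2 + ‖BTV Φ f (k + 1) a E false‖ ^ 2 ≤
      3 * (‖BTV Φ f k (a + 1) (E + 1) false‖ ^ 2 + ‖BTV Φ f k (a + 1) (E + 2) true‖ ^ 2) := by
    intro E
    rw [BTV_succ, BTV_succ]
    set P := BTV Φ f k (a + 1) (E + 1) false
    set Q := BTV Φ f k (a + 1) (E + 2) true
    have hcore := twAvgX_core (Φ a) hΦ3 hΦ1 Q P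
    simp only [bondPh, if_true, Bool.false_eq_true, if_false, one_mul, Bool.true_eq_false]
    rw [norm_mul, norm_mul, mul_pow, mul_pow]
    have h1 := hfa E
    have hA : 0 ≤ ‖P + Φ a * Q‖ ^ 2 := by positivity
    have hB : 0 ≤ ‖Φ a * P + Q‖ ^ 2 := by positivity
    have hcore' : ‖P + Φ a * Q‖ ^ 2 + ‖Φ a * P + Q‖ ^ 2 ≤ 3 * (‖P‖ ^ 2 + ‖Q‖ ^ 2) := by
      rw [add_comm (Φ a * P) Q, add_comm P (Φ a * Q)]
      linarith [hcore, add_comm (‖Φ a * Q + P‖ ^ 2) (‖Q + Φ a * P‖ ^ 2)]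
    nlinarith
  calc ∑ E : ZMod 3, (‖BTV Φ f (k + 1) a E true‖ ^ 2 + ‖BTV Φ f (k + 1) a E false‖ ^ 2)
      ≤ ∑ E : ZMod 3, 3 * (‖BTV Φ f k (a + 1) (E + 1) false‖ ^ 2 + ‖BTV Φ f k (a + 1) (E + 2) true‖ ^ 2) :=
        sum_le_sum fun E _ => hpt E
    _ = 3 * ((∑ E : ZMod 3, ‖BTV Φ f k (a + 1) (E + 1) false‖ ^ 2) +
          ∑ E : ZMod 3, ‖BTV Φ f k (a + 1) (E + 2) true‖ ^ 2) := by rw [← sum_add_distrib, mul_sum]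
    _ = 3 * ∑ E : ZMod 3, (‖BTV Φ f k (a + 1) E true‖ ^ 2 + ‖BTV Φ f k (a + 1) E false‖ ^ 2) := by
        rw [sum_shift 1 (fun E => ‖BTV Φ f k (a + 1) E false‖ ^ 2),
          sum_shift 2 (fun E => ‖BTV Φ f k (a + 1) E true‖ ^ 2), sum_add_distrib, add_comm]

/-- The terminal vector has squared norm `≤ 6`. -/
theorem btvNorm_zero_le (Φ : ℕ → ℂ) (f : ℕ → ZMod 3 → ℝ) (hf : ∀ j s, f j s ^ 2 ≤ 1) (a : ℕ) (hΦ : ‖Φ a‖ ≤ 1) :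
    btvNorm Φ f 0 a ≤ 6 := by
  unfold btvNorm cnsq6
  have hpt : ∀ (E : ZMod 3) (c : Bool), ‖BTV Φ f 0 a E c‖ ^ 2 ≤ 1 := by
    intro E c
    rw [BTV, norm_mul, mul_pow, Complex.norm_real, Real.norm_eq_abs, sq_abs]
    have h1 := hf a E
    have h2 : ‖bondPh Φ a c true‖ ^ 2 ≤ 1 := by
      unfold bondPh; split_ifs
      · exact pow_le_one₀ (norm_nonneg _) hΦ
      · simp
    have h3 : 0 ≤ ‖bondPh Φ a c true‖ ^ 2 := by positivity
    nlinarith [sq_nonneg (f a E)]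
  calc ∑ E : ZMod 3, (‖BTV Φ f 0 a E true‖ ^ 2 + ‖BTV Φ f 0 a E false‖ ^ 2)
      ≤ ∑ _E : ZMod 3, (2 : ℝ) := sum_le_sum fun E _ => by have := hpt E true; have := hpt E false; linarith
    _ = 6 := by rw [sum_const, card_univ, ZMod.card]; norm_num

/-- A single entry is bounded by the norm. -/
theorem normSq_le_btvNorm (Φ : ℕ → ℂ) (f : ℕ → ZMod 3 → ℝ) (k a : ℕ) (E : ZMod 3) (c : Bool) :
    ‖BTV Φ f k a E c‖ ^ 2 ≤ btvNorm Φ f k a := by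
  unfold btvNorm cnsq6
  have h := Finset.single_le_sum (f := fun E' : ZMod 3 => ‖BTV Φ f k a E' true‖ ^ 2 + ‖BTV Φ f k a E' false‖ ^ 2)
    (fun E' _ => by positivity) (mem_univ E)
  cases c
  · exact le_trans (by nlinarith [sq_nonneg ‖BTV Φ f k a E true‖]) h
  · exact le_trans (by nlinarith [sq_nonneg ‖BTV Φ f k a E false‖]) h

end BondTwist3

end Summit.QuantumAdvantage.AdviceFreeQNC0

end
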